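import Summits.ValiantsHypothesis.ValiantsHypothesis.Theorems.KPlusLogSqLawValuativeDoorProgressionFree

/-!
# LINE `valuative_door` (crux `WeakLifting`, stmt-ValiantsHypothesis-19561) — THE PROGRESSION-FREE COUNT AT THE LEVEL OF POLYNOMIALS:
# `#Dom(a c − b²) ≤ (2|E| − 3) + |E|` for ANY `a, b, c ∈ F[X]` supported in `E` whose progression binomials are cancellation-free

HONEST FRAMING.  Helper (cell `pub-symmetroid`, seat val-sym-lift-p1 g24, 2026-08-29; `--supports 19561 --as helper`), the letter-free form of
the landed `card_dominant_symm_le` (`…ValuativeDoorProgressionFree`, injective letter supports): the same sweep + chain argument for three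
arbitrary polynomials `a, b, c` with supports inside a finite set `E` of exponents, hypothesis at COEFFICIENT level (`x + y = 2z ⇒
v(a_x c_y − b_z²) = max(v(a_x c_y), v(b_z²))`), conclusion `#Dom(a c − b²) ≤ (2|E| − 3) + |E|` (`card_dominant_symm_poly_le`).  COROLLARY for
symmetric pencils with an ARBITRARY (not necessarily injective) support map `d : Fin K → ℕ` (`valProgressionFreeMerged_unfolded`): with the
hypothesis on the MERGED letters (the coefficients of the entry polynomials `Σ_l S_l X^{d_l}`), `npEdges ≤ 3K − 4` — the binders of the skeleton's
`ValRootLawAt 2 K (3K − 4)` plus the coefficient-level hypothesis, so a record row needs no injectivity side condition.  Nothing here is a stub of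
the line or closes anything; no bearing on vW / vB, `TropicalB`, `MatrixDescartes` (18050) or VP ≠ VNP.  [sweep + chain, letter-free]
-/

set_option linter.dupNamespace false
set_option autoImplicit false

namespace Summit.ValiantsHypothesis.ValiantsHypothesis.Theorems.KPlusLogSqLaw.ValDoor

open Polynomial Finset
open scoped BigOperators Classical

variable {F : Type*} [Field F]

/-- **THE PROGRESSION-FREE COUNT, LETTER-FREE**: for `a, b, c ∈ F[X]` with supports in `E` (`|E|` exponents) whose progression binomials
`a_x c_y − b_z²` (`x + y = 2z`) are cancellation-free, `a c − b²` has at most `(2|E| − 3) + |E|` dominant exponents (diagonal `2z` ≤ `|E|`,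
off-diagonal chain pairs inside `(E ∖ max) × (E ∖ min)` ≤ `2|E| − 3`). [same proof as the landed `card_dominant_symm_le`] -/
theorem card_dominant_symm_poly_le (v : AbsoluteValue F ℝ) (hv : IsNonarchimedean v) (a b c : F[X]) (E : Finset ℕ)
    (haE : a.support ⊆ E) (hbE : b.support ⊆ E) (hcE : c.support ⊆ E)
    (hfree : ∀ x y z : ℕ, x + y = z + z →
      v (a.coeff x * c.coeff y - b.coeff z * b.coeff z) = max (v (a.coeff x * c.coeff y)) (v (b.coeff z * b.coeff z))) :
    ((a * c - b * b).support.filter fun G => ∃ r : ℝ, 0 < r ∧ ∀ E' ∈ (a * c - b * b).support, E' ≠ G →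
        v ((a * c - b * b).coeff E') * r ^ E' < v ((a * c - b * b).coeff G) * r ^ G).card
      ≤ (2 * E.card - 3) + E.card := by
  set f : F[X] := a * c - b * b with hf
  set Df := f.support.filter fun E => ∃ r : ℝ, 0 < r ∧ ∀ E' ∈ f.support, E' ≠ E →
      v (f.coeff E') * r ^ E' < v (f.coeff E) * r ^ E with hDf
  set K : ℕ := E.card with hK
  have hEcard : E.card ≤ K := le_rfl
  have hDa : (a.support.filter fun G => ∃ r : ℝ, 0 < r ∧ ∀ E' ∈ a.support, E' ≠ G →
      v (a.coeff E') * r ^ E' < v (a.coeff G) * r ^ G).card ≤ K :=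
    (Finset.card_filter_le _ _).trans (Finset.card_le_card haE)
  have hDb : (b.support.filter fun G => ∃ r : ℝ, 0 < r ∧ ∀ E' ∈ b.support, E' ≠ G →
      v (b.coeff E') * r ^ E' < v (b.coeff G) * r ^ G).card ≤ K :=
    (Finset.card_filter_le _ _).trans (Finset.card_le_card hbE)
  have hDc : (c.support.filter fun G => ∃ r : ℝ, 0 < r ∧ ∀ E' ∈ c.support, E' ≠ G →
      v (c.coeff E') * r ^ E' < v (c.coeff G) * r ^ G).card ≤ K :=
    (Finset.card_filter_le _ _).trans (Finset.card_le_card hcE)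
  -- degenerate cases
  by_cases hb0 : b = 0
  · have h0 : f = a * c := by rw [hf, hb0, mul_zero, sub_zero]
    have h1 := card_dominant_mul_le v hv a c
    rw [hDf, h0]
    omega
  by_cases hac0 : a = 0 ∨ c = 0
  · have h0 : a * c = 0 := by rcases hac0 with h | h <;> simp [h]
    have h1 := card_dominant_sq_le v hv b
    rw [hDf, hf, h0, zero_sub, dominant_filter_neg]
    omega
  push Not at hac0
  obtain ⟨ha0, hc0⟩ := hac0
  -- the r-local hypothesis is implied by the coefficient-level one
  have hAP : ∀ (r : ℝ) (X Y Z : ℕ), 0 < r → a.coeff X ≠ 0 → c.coeff Y ≠ 0 → b.coeff Z ≠ 0 →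
      (∀ E' : ℕ, E' ≠ X → v (a.coeff E') * r ^ E' < v (a.coeff X) * r ^ X) →
      (∀ E' : ℕ, E' ≠ Y → v (c.coeff E') * r ^ E' < v (c.coeff Y) * r ^ Y) →
      (∀ E' : ℕ, E' ≠ Z → v (b.coeff E') * r ^ E' < v (b.coeff Z) * r ^ Z) →
      X + Y = Z + Z →
      v (a.coeff X * c.coeff Y - b.coeff Z * b.coeff Z) = max (v (a.coeff X * c.coeff Y)) (v (b.coeff Z * b.coeff Z)) :=
    fun _ X Y Z _ _ _ _ _ _ _ hS => hfree X Y Z hS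
  -- choose leads for every dominant exponent
  choose! rad lx ly zz hrad hax hcy hbz hx hy hGall hsplit using
    fun G (hG : G ∈ Df) => exists_leads_of_dominant_symm v hv a b c ha0 hb0 hc0 hAP hG
  -- diagonal and off-diagonal dominant exponents
  set Ddiag := Df.filter fun G => G = zz G + zz G ∨ (lx G) = (ly G) with hDdiag
  set Doff := Df.filter fun G => G = (lx G) + (ly G) ∧ (lx G) ≠ (ly G) with hDoff
  have hcover : Df ⊆ Doff ∪ Ddiag := by
    intro G hG
    rcases hsplit G hG with h | h
    · by_cases hxy : (lx G) = (ly G)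
      · exact Finset.mem_union_right _ (Finset.mem_filter.2 ⟨hG, Or.inr hxy⟩)
      · exact Finset.mem_union_left _ (Finset.mem_filter.2 ⟨hG, h, hxy⟩)
    · exact Finset.mem_union_right _ (Finset.mem_filter.2 ⟨hG, Or.inl h⟩)
  -- support exponents lie in `E`
  have hmemA : ∀ x : ℕ, a.coeff x ≠ 0 → x ∈ E := fun x hx => haE (Polynomial.mem_support_iff.2 hx)
  have hmemB : ∀ x : ℕ, b.coeff x ≠ 0 → x ∈ E := fun x hx => hbE (Polynomial.mem_support_iff.2 hx)
  have hmemC : ∀ x : ℕ, c.coeff x ≠ 0 → x ∈ E := fun x hx => hcE (Polynomial.mem_support_iff.2 hx)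
  -- the diagonal: at most `K`
  have hdiag : Ddiag.card ≤ K := by
    refine le_trans (Finset.card_le_card (fun G hG => ?_)) ((Finset.card_image_le (s := E) (f := fun x => x + x)).trans hEcard)
    obtain ⟨hGD, hG⟩ := Finset.mem_filter.1 hG
    rw [Finset.mem_image]
    rcases hG with h | h
    · exact ⟨zz G, hmemB _ (hbz G hGD), h.symm⟩
    · rcases hsplit G hGD with h2 | h2
      · exact ⟨(lx G), hmemA _ (hax G hGD), ((congrArg (fun t => (lx G) + t) h.symm).symm.trans h2.symm)⟩
      · exact ⟨zz G, hmemB _ (hbz G hGD), h2.symm⟩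
  -- the off-diagonal pairs form a chain in `(E ∖ max) × (E ∖ min)`
  have hoff : Doff.card ≤ 2 * K - 3 := by
    by_cases hEne : E.Nonempty
    swap
    · -- no letters: nothing is dominant
      have hDoff0 : Doff = ∅ := by
        rw [Finset.eq_empty_iff_forall_notMem]
        intro G hG
        obtain ⟨hGD, -, -⟩ := Finset.mem_filter.1 hG
        exact hEne ⟨_, hmemA _ (hax G hGD)⟩
      rw [hDoff0, Finset.card_empty]
      exact Nat.zero_le _
    set φ : ℕ → ℕ × ℕ := fun G => (min (lx G) (ly G), max (lx G) (ly G)) with hφ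
    have hinj : Set.InjOn φ (Doff : Set ℕ) := by
      intro G hG G' hG' h
      obtain ⟨-, hGs, -⟩ := Finset.mem_filter.1 (Finset.mem_coe.1 hG)
      obtain ⟨-, hG's, -⟩ := Finset.mem_filter.1 (Finset.mem_coe.1 hG')
      have h1 : min (lx G) (ly G) + max (lx G) (ly G) = min (lx G') (ly G') + max (lx G') (ly G') := by
        have := congrArg (fun q : ℕ × ℕ => q.1 + q.2) h
        simpa [hφ] using this
      rw [min_add_max, min_add_max] at h1
      rw [hGs, hG's, h1]
    set A := E.erase (E.max' hEne) with hA
    set B := E.erase (E.min' hEne) with hB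
    have hmem : ∀ q ∈ Doff.image φ, q.1 ∈ A ∧ q.2 ∈ B := by
      intro q hq
      obtain ⟨G, hG, rfl⟩ := Finset.mem_image.1 hq
      obtain ⟨hGD, -, hne⟩ := Finset.mem_filter.1 hG
      have h1 : (lx G) ∈ E := hmemA _ (hax G hGD)
      have h2 : (ly G) ∈ E := hmemC _ (hcy G hGD)
      have hminE : min (lx G) (ly G) ∈ E := by rcases min_choice (lx G) (ly G) with h | h <;> rw [h] <;> assumption
      have hmaxE : max (lx G) (ly G) ∈ E := by rcases max_choice (lx G) (ly G) with h | h <;> rw [h] <;> assumption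
      have hlt : min (lx G) (ly G) < max (lx G) (ly G) := min_lt_max.2 hne
      refine ⟨Finset.mem_erase.2 ⟨?_, hminE⟩, Finset.mem_erase.2 ⟨?_, hmaxE⟩⟩
      · exact (hlt.trans_le (Finset.le_max' E _ hmaxE)).ne
      · exact ((Finset.min'_le E _ hminE).trans_lt hlt).ne'
    have hchain : ∀ q ∈ Doff.image φ, ∀ q' ∈ Doff.image φ, (q.1 ≤ q'.1 ∧ q.2 ≤ q'.2) ∨ (q'.1 ≤ q.1 ∧ q'.2 ≤ q.2) := by
      intro q hq q' hq'
      obtain ⟨G, hG, rfl⟩ := Finset.mem_image.1 hq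
      obtain ⟨G', hG', rfl⟩ := Finset.mem_image.1 hq'
      have hGD : G ∈ Df := (Finset.mem_filter.1 hG).1
      have hG'D : G' ∈ Df := (Finset.mem_filter.1 hG').1
      have mono : ∀ {G₁ G₂ : ℕ}, G₁ ∈ Df → G₂ ∈ Df → rad G₁ < rad G₂ →
          (φ G₁).1 ≤ (φ G₂).1 ∧ (φ G₁).2 ≤ (φ G₂).2 := by
        intro G₁ G₂ h₁ h₂ hlt
        have m1 : (lx G₁) ≤ (lx G₂) := dominantAt_mono v a (hrad G₁ h₁) hlt (hx G₁ h₁) (hx G₂ h₂)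
        have m2 : (ly G₁) ≤ (ly G₂) := dominantAt_mono v c (hrad G₁ h₁) hlt (hy G₁ h₁) (hy G₂ h₂)
        exact ⟨min_le_min m1 m2, max_le_max m1 m2⟩
      rcases lt_trichotomy (rad G) (rad G') with h | h | h
      · exact Or.inl (mono hGD hG'D h)
      · -- same radius: same leads
        left
        have e1 : (lx G) = (lx G') := by
          by_contra hne
          have u1 := hx G hGD (lx G') (fun h' => hne h'.symm)
          have u2 := hx G' hG'D (lx G) hne
          rw [h] at u1
          exact lt_asymm u1 u2
        have e2 : (ly G) = (ly G') := by
          by_contra hne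
          have u1 := hy G hGD (ly G') (fun h' => hne h'.symm)
          have u2 := hy G' hG'D (ly G) hne
          rw [h] at u1
          exact lt_asymm u1 u2
        simp only [hφ]
        rw [e1, e2]
        exact ⟨le_rfl, le_rfl⟩
      · exact Or.inr (mono hG'D hGD h)
    have hcard := card_chain_le A B (Doff.image φ) hmem hchain
    have hAc : A.card ≤ K - 1 := by
      rw [hA, Finset.card_erase_of_mem (Finset.max'_mem E hEne)]
    have hBc : B.card ≤ K - 1 := by
      rw [hB, Finset.card_erase_of_mem (Finset.min'_mem E hEne)]
    calc Doff.card = (Doff.image φ).card := (Finset.card_image_of_injOn hinj).symm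
      _ ≤ A.card + B.card - 1 := hcard
      _ ≤ 2 * K - 3 := by omega
  calc Df.card ≤ (Doff ∪ Ddiag).card := Finset.card_le_card hcover
    _ ≤ Doff.card + Ddiag.card := Finset.card_union_le _ _
    _ ≤ (2 * K - 3) + K := Nat.add_le_add hoff hdiag


/-- **SYMMETRIC PENCILS WITH AN ARBITRARY SUPPORT MAP, UNFOLDED**: for `d : Fin K → ℕ` not necessarily injective, with the progression
hypothesis on the MERGED letters (coefficients of the entry polynomials), the determinant has `npEdges ≤ 3K − 4`. [corollary: `E = image d`] -/
theorem valProgressionFreeMerged_unfolded :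
    ∀ (F : Type) [Field F] (v : AbsoluteValue F ℝ), IsNonarchimedean v →
      ∀ (K : ℕ) (d : Fin K → ℕ) (S : Fin K → Matrix (Fin 2) (Fin 2) F), (∀ l, (S l).IsSymm) →
        (∀ x y z : ℕ, x + y = z + z →
          v ((∑ l, C (S l 0 0) * (X : F[X]) ^ d l).coeff x * (∑ l, C (S l 1 1) * (X : F[X]) ^ d l).coeff y
              - (∑ l, C (S l 0 1) * (X : F[X]) ^ d l).coeff z * (∑ l, C (S l 0 1) * (X : F[X]) ^ d l).coeff z)
            = max (v ((∑ l, C (S l 0 0) * (X : F[X]) ^ d l).coeff x * (∑ l, C (S l 1 1) * (X : F[X]) ^ d l).coeff y))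
                (v ((∑ l, C (S l 0 1) * (X : F[X]) ^ d l).coeff z * (∑ l, C (S l 0 1) * (X : F[X]) ^ d l).coeff z))) →
        ((Matrix.det (∑ l, ((X : F[X]) ^ d l) • (S l).map (C : F →+* F[X]))).support.filter fun E =>
            ∃ r : ℝ, 0 < r ∧ ∀ E' ∈ (Matrix.det (∑ l, ((X : F[X]) ^ d l) • (S l).map (C : F →+* F[X]))).support, E' ≠ E →
              v ((Matrix.det (∑ l, ((X : F[X]) ^ d l) • (S l).map (C : F →+* F[X]))).coeff E') * r ^ E'
                < v ((Matrix.det (∑ l, ((X : F[X]) ^ d l) • (S l).map (C : F →+* F[X]))).coeff E) * r ^ E).card - 1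
          ≤ 3 * K - 4 := by
  intro F _ v hv K d S hS hfree
  have hentry : ∀ i j : Fin 2, (∑ l, ((X : F[X]) ^ d l) • (S l).map (C : F →+* F[X])) i j = ∑ l, C (S l i j) * X ^ d l := by
    intro i j
    rw [Matrix.sum_apply]
    refine Finset.sum_congr rfl fun l _ => ?_
    rw [Matrix.smul_apply, Matrix.map_apply, smul_eq_mul, mul_comm]
  have hsym : ∀ l, S l 1 0 = S l 0 1 := fun l => (hS l).apply 0 1
  rw [Matrix.det_fin_two, hentry, hentry, hentry, hentry]
  simp only [hsym]
  set E : Finset ℕ := (univ : Finset (Fin K)).image d with hE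
  have hEcard : E.card ≤ K := Finset.card_image_le.trans (by rw [Finset.card_univ, Fintype.card_fin])
  have hsub : ∀ g : Fin K → F, (∑ l, C (g l) * (X : F[X]) ^ d l).support ⊆ E := by
    intro g x hx
    obtain ⟨l, hl⟩ := exists_letter_of_coeff_ne_zero d g (Polynomial.mem_support_iff.1 hx)
    exact Finset.mem_image.2 ⟨l, Finset.mem_univ _, hl⟩
  have h := card_dominant_symm_poly_le v hv (∑ l, C (S l 0 0) * (X : F[X]) ^ d l) (∑ l, C (S l 0 1) * (X : F[X]) ^ d l)
    (∑ l, C (S l 1 1) * (X : F[X]) ^ d l) E (hsub _) (hsub _) (hsub _) hfree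
  omega

end Summit.ValiantsHypothesis.ValiantsHypothesis.Theorems.KPlusLogSqLaw.ValDoor
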